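import Summits.ResolutionOfSingularities.ResolutionOfSingularities.Theorems.FrobeniusClosingSteerBinaryResidueWindowKernelOdd
import Summits.ResolutionOfSingularities.ResolutionOfSingularities.Theorems.FrobeniusClosingSteerBinaryResidueSatelliteKernel
import Summits.ResolutionOfSingularities.ResolutionOfSingularities.Theorems.FrobeniusClosingSteerSwitchPlaneChart
import Summits.ResolutionOfSingularities.ResolutionOfSingularities.Theorems.FrobeniusClosingSteerSigmaTopLegalityOddDivisor
import Literature.AlgebraicGeometry.Resolution.StrictNormalCrossingsDescent
import HarnessLib

/-!
# hARᵒ H2 — F3: **an ODD SATELLITE forces an ON-AXIS BINARY RESIDUE at the A-stage** (three-member assembly, RATIONAL windows;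
# characteristic `2`; Theses-free, def-free)

OURS (campaign `res-hironaka`, rung L ★L-G4, slot W4.1 · crux `Steer` (stmt-ResolutionOfSingularities-16345) · hARᵒ slot H2, case (i)/(ii, k ≥ 2) of
res-L0-w41-tri-1's RULING-REPLY 2026-08-27 15:06Z = tri-1 TRIAGE v6.10 (R2) «satellite `B₁ → B₂` ⇒ `Φ_A` binary»; res-type-062 g15
`H2-DESIGN.md` v1 §2 (a)–(e)). Over F1 `BinaryResidue.mem_sup_of_window` (p545669), F2 `BinaryResidue.mem_sup_of_satellite_window` + the parity
lemma (p546632) and res-type-028's window-kernel plumbing. Not a statement of the manuscript under review [claim: Hironaka2017, status: under-review];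
AI-produced, weaker than expert review.

THE SETTING (three consecutive members `S₀ ≤ S₁ ≤ S₂ ⊆ L` of the run: the A-stage, the visit `B₁` after it, the visit `B₂` after that; both point
windows ADAPTED and RATIONAL). Window 1: `𝔪_{S₀} = (x, u₁, u₂, u₃)`, `𝔪_{S₁} = (x, u')`, `u_j = x·u'_j`. Window 2: `𝔪_{S₁} = (x₁, v₀, v₁, v₂)` with
**`v₀ = x`** (the SATELLITE condition: the centre of `S₂` lies on the strict transform of `V(x)`), `𝔪_{S₂} = (x₁, v')`, `v_j = x₁·v'_j`. Radicands:
`f₀ − G₀² ∈ 𝔪_{S₀}^d` (`d + 1 = 2e`: odd cleaned order `d` at the A-stage), the point-step-plus-strips laws `f₁·x^(d−1)·W² = f₀ − G²`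
(`G, W ∈ S₁`) and `f₂·x₁^(d+1)·W₁² = f₁ − G₁²` (`G₁, W₁ ∈ S₂`) — the squared forms of `VisitLawDelta.visitLaw₂_of_run` — and cleaned order `≥ d + 1`
at `S₁` and at `S₂` (the B-stages).

* §1 helpers: `not_mem_sq_of_span_eq` (a minimal generator is not in `𝔪²`), `pow_dvd_of_pow_two_mul_dvd_sq` (`x^(2m) ∣ a² ⇒ x^m ∣ a` for a prime
  `x`), `exists_mul_pow_eq_of_mem_pow` (weak transforms exist: `z ∈ 𝔪_S^k ⇒ z = z'·x^k`, `z' ∈ S'`), `inclusion_mem_span_of_mem_maximalIdeal`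
  (`𝔪_S ⊆ x·S'`).
* §2 **`binaryResidue_of_oddSatellite`** — THE THEOREM: in the setting above, `f₀ − G₀² ∈ (σ, τ)^d + 𝔪_{S₀}^(d+1)` for some `σ, τ ∈ (u₁, u₂, u₃)`
  with `IsRsopPart ![σ, τ]` — a BINARY residue at the A-stage whose axis `V(σ, τ)` passes (to first order) through the next centre («on-axis»:
  `σ/x, τ/x ∈ 𝔪_{S₁}`). Chain: STRUCTURE `W²f₁ = x·h̃ + Δ′²` (`h̃ = (f₀ − G₀²)/x^d`, prime-power divisibility) → PARITY LEMMA (`h̃′ = h̃ − x q² ∈ 𝔪_{S₁}^d`)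
  → F2 at window 2 (`h̃′ ∈ (x) + (v₁, v₂)^d + 𝔪^(d+1)`) → F1 at window 1 with `m = 2` → `IsRsopPart` from F1's linear parts and the two regular
  systems (`mem_maximalIdeal_of_sum_mul_rsop_mem_sq`).
[cite: Matsumura1987, Thm. 14.2, Thm. 17.10] [folklore]
-/

noncomputable section

-- `Summit.<S>.<S>.…` duplicates the summit name by design (single-problem summit).
set_option linter.dupNamespace false

open IsLocalRing MvPolynomial

namespace Summit.ResolutionOfSingularities.ResolutionOfSingularities.Theorems.SwitchingDichotomy.BinaryResidue

open Literature.AlgebraicGeometry.Resolution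

/-! ## §1 Helpers -/

section helpers

variable {A : Type} [CommRing A]

/-- A member of a minimal system of generators of the maximal ideal of a regular local ring (as many generators as the dimension) does not lie
in `𝔪²`. [cite: Matsumura1987, Thm. 14.2] -/
theorem not_mem_sq_of_span_eq [IsRegularLocalRing A] {n : ℕ} (hn : (maximalIdeal A).spanFinrank = n) (z : Fin n → A)
    (hz : Ideal.span (Set.range z) = maximalIdeal A) (i : Fin n) : z i ∉ maximalIdeal A ^ 2 := by
  classical
  intro hi
  have h := mem_maximalIdeal_of_sum_mul_rsop_mem_sq hn z hz (Pi.single i 1) (by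
    rw [Finset.sum_eq_single i (fun j _ hj => by simp [hj]) (by simp)]
    simpa using hi) i
  simp only [Pi.single_eq_same] at h
  exact (IsLocalRing.maximalIdeal.isMaximal A).ne_top (Ideal.eq_top_of_isUnit_mem _ h isUnit_one)

/-- For a prime `x` of a domain: `x^(2m) ∣ a² ⇒ x^m ∣ a`. [folklore] -/
theorem pow_dvd_of_pow_two_mul_dvd_sq [IsDomain A] {x : A} (hx : Prime x) :
    ∀ (m : ℕ) {a : A}, x ^ (2 * m) ∣ a ^ 2 → x ^ m ∣ a := by
  intro m
  induction m with
  | zero => intro a _; simp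
  | succ m ih =>
    intro a h
    have hxa : x ∣ a := hx.dvd_of_dvd_pow (dvd_trans (dvd_pow_self x (by omega)) h)
    obtain ⟨a₁, rfl⟩ := hxa
    have h' : x ^ (2 * m) ∣ a₁ ^ 2 := by
      have e : (x * a₁) ^ 2 = x ^ 2 * a₁ ^ 2 := by ring
      rw [e, show 2 * (m + 1) = 2 + 2 * m by ring, pow_add] at h
      exact (mul_dvd_mul_iff_left (pow_ne_zero 2 hx.ne_zero)).mp h
    obtain ⟨b, hb⟩ := ih h'
    exact ⟨b, by rw [hb]; ring⟩

variable {L : Type} [Field L]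

/-- **Weak transforms exist.** In a point window `S ≤ S'` with `𝔪_S = (x, u)` and `u_j = x·u'_j`, `u'_j ∈ S'`: every `z ∈ 𝔪_S^k` is `z'·x^k` with
`z' ∈ S'`. [folklore] -/
theorem exists_mul_pow_eq_of_mem_pow {S S' : Subring L} [IsLocalRing S] (hle : S ≤ S') (x : S) {n : ℕ} (u : Fin n → S)
    (hxu : Ideal.span (insert x (Set.range u)) = maximalIdeal S)
    (u' : Fin n → S') (hu : ∀ j, ((u j : S) : L) = (x : L) * ((u' j : S') : L)) {k : ℕ} {z : S}
    (hz : z ∈ maximalIdeal S ^ k) : ∃ z' : S', ((z' : S') : L) * (x : L) ^ k = ((z : S) : L) := by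
  classical
  set xu : Fin (n + 1) → S := Fin.cons x u with hxudef
  have hz' : z ∈ Ideal.span (Set.range xu) ^ k := by rwa [hxudef, Fin.range_cons, hxu]
  obtain ⟨Φ, hΦ, hΦev⟩ := exists_isHomogeneous_of_mem_span_pow xu k hz'
  set incl : S →+* S' := Subring.inclusion hle with hincl
  refine ⟨eval₂ incl (Fin.cons 1 u' : Fin (n + 1) → S') Φ, ?_⟩
  set uL : Fin n → L := fun j => ((u' j : S') : L) with huL
  have hcons : (⇑S.subtype ∘ xu) = (x : L) • (Fin.cons 1 uL : Fin (n + 1) → L) := by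
    funext i
    refine Fin.cases ?_ (fun j => ?_) i
    · simp [hxudef]
    · simp [hxudef, huL, hu j]
  have hcons' : (⇑S'.subtype ∘ (Fin.cons 1 u' : Fin (n + 1) → S')) = (Fin.cons 1 uL : Fin (n + 1) → L) := by
    funext i
    refine Fin.cases ?_ (fun j => ?_) i
    · simp
    · simp [huL]
  have h1 : ((z : S) : L) = (x : L) ^ k * eval₂ S.subtype (Fin.cons 1 uL : Fin (n + 1) → L) Φ := by
    rw [show ((z : S) : L) = S.subtype z from rfl, ← hΦev, show eval xu Φ = eval₂ (RingHom.id S) xu Φ from rfl,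
      eval₂_comp_left, RingHom.comp_id, hcons, eval₂_smul_eq S.subtype hΦ]
  have h2 : ((eval₂ incl (Fin.cons 1 u' : Fin (n + 1) → S') Φ : S') : L) = eval₂ S.subtype (Fin.cons 1 uL : Fin (n + 1) → L) Φ := by
    rw [show ((eval₂ incl (Fin.cons 1 u' : Fin (n + 1) → S') Φ : S') : L) = S'.subtype (eval₂ incl (Fin.cons 1 u') Φ) from rfl,
      eval₂_comp_left, hcons']
    rfl
  rw [h2, h1, mul_comm]

/-- In a point window `𝔪_S ⊆ x·S'`. [folklore] -/
theorem inclusion_mem_span_of_mem_maximalIdeal {S S' : Subring L} [IsLocalRing S] (hle : S ≤ S') (x : S) {n : ℕ} (u : Fin n → S)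
    (hxu : Ideal.span (insert x (Set.range u)) = maximalIdeal S)
    (u' : Fin n → S') (hu : ∀ j, ((u j : S) : L) = (x : L) * ((u' j : S') : L)) {b : S} (hb : b ∈ maximalIdeal S) :
    (⟨(b : L), hle b.2⟩ : S') ∈ Ideal.span {(⟨(x : L), hle x.2⟩ : S')} := by
  rw [← hxu] at hb
  refine Submodule.span_induction ?_ ?_ (fun a b _ _ ha hb => ?_) (fun r a _ ha => ?_) hb
  · rintro a (rfl | ⟨j, rfl⟩)
    · exact Ideal.mem_span_singleton_self _
    · have : (⟨((u j : S) : L), hle (u j).2⟩ : S') = ⟨(x : L), hle x.2⟩ * u' j := Subtype.ext (hu j)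
      rw [this]
      exact Ideal.mul_mem_right _ _ (Ideal.mem_span_singleton_self _)
  · have : (⟨((0 : S) : L), hle (0 : S).2⟩ : S') = 0 := Subtype.ext (by simp)
    rw [this]; exact zero_mem _
  · have : (⟨((a + b : S) : L), hle (a + b).2⟩ : S') = ⟨(a : L), hle a.2⟩ + ⟨(b : L), hle b.2⟩ := Subtype.ext rfl
    exact this ▸ add_mem ha hb
  · have : (⟨((r • a : S) : L), hle (r • a).2⟩ : S') = ⟨(r : L), hle r.2⟩ * ⟨(a : L), hle a.2⟩ := Subtype.ext rfl
    rw [this]; exact Ideal.mul_mem_left _ _ ha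

end helpers

/-! ## §2 The odd-satellite assembly -/

section assembly

variable {L : Type} [Field L]

/-- **An ODD SATELLITE forces an ON-AXIS BINARY RESIDUE at the A-stage.** See the module docstring for the setting. Conclusion:
`f₀ − G₀² ∈ (σ, τ)^d + 𝔪_{S₀}^(d+1)` with `σ, τ ∈ (u₁, u₂, u₃)` (so `σ/x, τ/x ∈ S₁`'s maximal ideal: the axis passes through the next centre) and
`IsRsopPart ![σ, τ]`. [cite: Matsumura1987, Thm. 14.2, Thm. 17.10] [folklore] -/
theorem binaryResidue_of_oddSatellite (h2 : (2 : L) = 0) (S₀ S₁ S₂ : Subring L) [IsLocalRing S₀] [IsLocalRing S₁] [IsLocalRing S₂]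
    (h01 : S₀ ≤ S₁) (h12 : S₁ ≤ S₂) (hreg₀ : IsRegularLocalRing S₀) (hreg₁ : IsRegularLocalRing S₁) (hreg₂ : IsRegularLocalRing S₂)
    (hdim₀ : ringKrullDim S₀ = (4 : ℕ)) (hdim₁ : ringKrullDim S₁ = (4 : ℕ)) (hdim₂ : ringKrullDim S₂ = (4 : ℕ))
    -- window 1 (A-stage → B₁)
    (x : S₀) (hx0 : (x : L) ≠ 0) (u : Fin 3 → S₀) (hxu : Ideal.span (insert x (Set.range u)) = maximalIdeal S₀)
    (u' : Fin 3 → S₁) (hu : ∀ j, ((u j : S₀) : L) = (x : L) * ((u' j : S₁) : L))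
    (hm₁ : Ideal.span (insert (⟨(x : L), h01 x.2⟩ : S₁) (Set.range u')) = maximalIdeal S₁)
    (hrat₁ : ∀ a : S₁, ∃ b : S₀, a - ⟨(b : L), h01 b.2⟩ ∈ maximalIdeal S₁)
    -- window 2 (B₁ → B₂), satellite: `v 0 = x`
    (x₁ : S₁) (hx₁0 : (x₁ : L) ≠ 0) (v : Fin 3 → S₁) (hv0 : ((v 0 : S₁) : L) = (x : L))
    (hx₁v : Ideal.span (insert x₁ (Set.range v)) = maximalIdeal S₁)
    (v' : Fin 3 → S₂) (hv : ∀ j, ((v j : S₁) : L) = (x₁ : L) * ((v' j : S₂) : L))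
    (hm₂ : Ideal.span (insert (⟨(x₁ : L), h12 x₁.2⟩ : S₂) (Set.range v')) = maximalIdeal S₂)
    (hrat₂ : ∀ a : S₂, ∃ b : S₁, a - ⟨(b : L), h12 b.2⟩ ∈ maximalIdeal S₂)
    -- radicands
    {d e : ℕ} (hde : d + 1 = 2 * e) (f₀ G₀ : S₀) (hG₀ : f₀ - G₀ ^ 2 ∈ maximalIdeal S₀ ^ d)
    (f₁ G W : S₁) (hlaw₁ : ((f₁ : S₁) : L) * (x : L) ^ (d - 1) * ((W : S₁) : L) ^ 2 = ((f₀ : S₀) : L) - ((G : S₁) : L) ^ 2)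
    (hclean₁ : ∃ γ₁ : S₁, f₁ - γ₁ ^ 2 ∈ maximalIdeal S₁ ^ (d + 1))
    (f₂ G₁ W₁ : S₂) (hlaw₂ : ((f₂ : S₂) : L) * (x₁ : L) ^ (d + 1) * ((W₁ : S₂) : L) ^ 2 = ((f₁ : S₁) : L) - ((G₁ : S₂) : L) ^ 2)
    (hclean₂ : ∃ γ₂ : S₂, f₂ - γ₂ ^ 2 ∈ maximalIdeal S₂ ^ (d + 1)) :
    ∃ σ τ : S₀, σ ∈ Ideal.span (Set.range u) ∧ τ ∈ Ideal.span (Set.range u) ∧ IsRsopPart ![σ, τ] ∧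
      f₀ - G₀ ^ 2 ∈ Ideal.span {σ, τ} ^ d ⊔ maximalIdeal S₀ ^ (d + 1) := by
  classical
  haveI := hreg₀; haveI := hreg₁; haveI := hreg₂
  haveI := isDomain_of_isRegularLocalRing S₁
  haveI := isDomain_of_isRegularLocalRing S₂
  have he : 1 ≤ e := by omega
  have hd1 : d - 1 = 2 * (e - 1) := by omega
  -- characteristic 2 in the members
  have h2S₁ : (2 : S₁) = 0 := Subtype.ext (by change S₁.subtype 2 = S₁.subtype 0; rw [map_ofNat, map_zero]; exact h2)
  have h2S₂ : (2 : S₂) = 0 := Subtype.ext (by change S₂.subtype 2 = S₂.subtype 0; rw [map_ofNat, map_zero]; exact h2)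
  -- the regular systems as `Fin 4`-families
  have hsfr : ∀ (S : Subring L) [IsRegularLocalRing S], ringKrullDim S = (4 : ℕ) → (maximalIdeal S).spanFinrank = 4 := by
    intro S _ hdim
    have h := IsRegularLocalRing.spanFinrank_maximalIdeal (R := S)
    rw [hdim] at h
    exact_mod_cast h
  set z₀ : Fin 4 → S₀ := Fin.cons x u with hz₀
  have hz₀span : Ideal.span (Set.range z₀) = maximalIdeal S₀ := by rw [hz₀, Fin.range_cons, hxu]
  set z₁ : Fin 4 → S₁ := Fin.cons x₁ v with hz₁
  have hz₁span : Ideal.span (Set.range z₁) = maximalIdeal S₁ := by rw [hz₁, Fin.range_cons, hx₁v]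
  set xS₁ : S₁ := ⟨(x : L), h01 x.2⟩ with hxS₁
  have hv0' : v 0 = xS₁ := Subtype.ext hv0
  set x₁S₂ : S₂ := ⟨(x₁ : L), h12 x₁.2⟩ with hx₁S₂
  set z₂ : Fin 4 → S₂ := Fin.cons x₁S₂ v' with hz₂
  have hz₂span : Ideal.span (Set.range z₂) = maximalIdeal S₂ := by rw [hz₂, Fin.range_cons, hm₂]
  -- `x ∈ 𝔪_{S₁} ∖ 𝔪_{S₁}²`, prime in `S₁`; `x₁ ∈ 𝔪_{S₂} ∖ 𝔪_{S₂}²`, prime in `S₂`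
  have hxm₁ : xS₁ ∈ maximalIdeal S₁ := by rw [← hv0', ← hx₁v]; exact Ideal.subset_span (Set.mem_insert_of_mem _ ⟨0, rfl⟩)
  have hx2₁ : xS₁ ∉ maximalIdeal S₁ ^ 2 := by
    rw [← hv0']
    exact not_mem_sq_of_span_eq (hsfr S₁ hdim₁) z₁ hz₁span (Fin.succ 0)
  have hxS₁0 : xS₁ ≠ 0 := fun h => hx0 (congrArg Subtype.val h)
  have hxprime : Prime xS₁ :=
    (Ideal.span_singleton_prime hxS₁0).mp (SigmaTopLegality.isPrime_span_singleton_of_not_mem_sq S₁ hxm₁ hx2₁)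
  have hx₁m₂ : x₁S₂ ∈ maximalIdeal S₂ := by rw [← hm₂]; exact Ideal.subset_span (Set.mem_insert _ _)
  have hx₁2₂ : x₁S₂ ∉ maximalIdeal S₂ ^ 2 := not_mem_sq_of_span_eq (hsfr S₂ hdim₂) z₂ hz₂span 0
  have hx₁S₂0 : x₁S₂ ≠ 0 := fun h => hx₁0 (congrArg Subtype.val h)
  have hx₁prime : Prime x₁S₂ :=
    (Ideal.span_singleton_prime hx₁S₂0).mp (SigmaTopLegality.isPrime_span_singleton_of_not_mem_sq S₂ hx₁m₂ hx₁2₂)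
  -- (a) STRUCTURE: the weak transform `h̃ = (f₀ − G₀²)/x^d ∈ S₁` and `W²·f₁ = x·h̃ + Δ′²`
  obtain ⟨ht, hht⟩ := exists_mul_pow_eq_of_mem_pow h01 x u hxu u' hu hG₀
  set G₀S₁ : S₁ := ⟨(G₀ : L), h01 G₀.2⟩ with hG₀S₁
  have hxL : ((xS₁ : S₁) : L) = (x : L) := rfl
  have hGL : ((G₀S₁ : S₁) : L) = (G₀ : L) := rfl
  have hsq : (G₀S₁ - G) ^ 2 = xS₁ ^ (d - 1) * (W ^ 2 * f₁ - xS₁ * ht) := by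
    apply Subtype.ext
    push_cast
    rw [hxL, hGL]
    have e1 : (x : L) ^ d = (x : L) ^ (d - 1) * (x : L) := by rw [← pow_succ, show d - 1 + 1 = d by omega]
    have hhtd : ((ht : S₁) : L) * ((x : L) ^ (d - 1) * (x : L)) = ((f₀ : S₀) : L) - ((G₀ : S₀) : L) ^ 2 := by
      rw [← e1, hht]; push_cast; ring
    linear_combination (-1 : L) * hlaw₁ + (1 : L) * hhtd +
      (((G : S₁) : L) * (((G : S₁) : L) - ((G₀ : S₀) : L))) * h2
  have hsq' : (G₀S₁ - G) ^ 2 = xS₁ ^ (2 * (e - 1)) * (W ^ 2 * f₁ - xS₁ * ht) := by rw [← hd1]; exact hsq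
  obtain ⟨Δ, hΔ⟩ := pow_dvd_of_pow_two_mul_dvd_sq hxprime (e - 1) (a := G₀S₁ - G) ⟨_, hsq'⟩
  have hstruct : W ^ 2 * f₁ = xS₁ * ht + Δ ^ 2 := by
    have hne : xS₁ ^ (2 * (e - 1)) ≠ 0 := pow_ne_zero _ hxS₁0
    have h3 : xS₁ ^ (2 * (e - 1)) * (W ^ 2 * f₁ - xS₁ * ht) = xS₁ ^ (2 * (e - 1)) * Δ ^ 2 := by
      rw [← hsq', hΔ]; ring
    have h4 := mul_left_cancel₀ hne h3
    linear_combination h4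
  -- (b) PARITY: `x·h̃ − (W γ₁ + Δ)² ∈ 𝔪^(d+1)` ⇒ `h̃′ := h̃ − x q² ∈ 𝔪^d`
  obtain ⟨γ₁, hγ₁⟩ := hclean₁
  have hrel : xS₁ * ht - (W * γ₁ + Δ) ^ 2 ∈ maximalIdeal S₁ ^ (2 * e) := by
    have : xS₁ * ht - (W * γ₁ + Δ) ^ 2 = W ^ 2 * (f₁ - γ₁ ^ 2) := by
      linear_combination (-1 : S₁) * hstruct + (-(W * γ₁ * Δ) - Δ ^ 2) * h2S₁
    rw [this, ← hde]
    exact Ideal.mul_mem_left _ _ hγ₁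
  obtain ⟨q, hq⟩ := exists_sub_mul_sq_mem_pow_of_mul_sub_sq_mem_pow h2S₁ hxm₁ hx2₁ he hrel
  rw [show 2 * e - 1 = d by omega] at hq
  set ht' : S₁ := ht - xS₁ * q ^ 2 with hht'
  -- (d) F2 at window 2: `h̃′ ∈ (x) + (v₁, v₂)^d + 𝔪^(d+1)`
  obtain ⟨ht'', hht''⟩ := exists_mul_pow_eq_of_mem_pow h12 x₁ v hx₁v v' hv hq
  have hdim₂' : ringKrullDim S₂ = ((2 : ℕ) + 1 + 1 : ℕ) := by rw [hdim₂]
  -- the member at `S₂`: `W² W₁² x₁^(d+1) f₂ = x h̃′ + ρ²`, `ρ = x q + Δ + W G₁`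
  have h02 : S₀ ≤ S₂ := h01.trans h12
  set WS₂ : S₂ := ⟨(W : L), h12 W.2⟩ with hWS₂
  have hWL : ((WS₂ : S₂) : L) = (W : L) := rfl
  have hx₁L : ((x₁S₂ : S₂) : L) = (x₁ : L) := rfl
  set ρ : S₂ := ⟨(x : L) * ((q : S₁) : L) + ((Δ : S₁) : L) + ((W : S₁) : L) * ((G₁ : S₂) : L),
    S₂.add_mem (S₂.add_mem (S₂.mul_mem (h02 x.2) (h12 q.2)) (h12 Δ.2)) (S₂.mul_mem (h12 W.2) G₁.2)⟩ with hρ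
  have hρL : ((ρ : S₂) : L) = (x : L) * ((q : S₁) : L) + ((Δ : S₁) : L) + ((W : S₁) : L) * ((G₁ : S₂) : L) := rfl
  have hht'L : ((ht' : S₁) : L) = ((ht : S₁) : L) - (x : L) * ((q : S₁) : L) ^ 2 := by
    rw [hht']; push_cast; rw [hxL]
  have hmem₂ : WS₂ ^ 2 * W₁ ^ 2 * x₁S₂ ^ (d + 1) * f₂ = v' 0 * x₁S₂ * (ht'' * x₁S₂ ^ d) + ρ ^ 2 := by
    apply Subtype.ext
    push_cast
    rw [hWL, hx₁L, hρL, hht'', hht'L]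
    have hv0L : ((v' 0 : S₂) : L) * (x₁ : L) = (x : L) := by rw [mul_comm, ← hv 0, hv0]
    have hstructL : ((W : S₁) : L) ^ 2 * ((f₁ : S₁) : L) = (x : L) * ((ht : S₁) : L) + ((Δ : S₁) : L) ^ 2 := by
      have := congrArg Subtype.val hstruct
      push_cast at this
      rw [hxL] at this
      exact this
    linear_combination (((W : S₁) : L) ^ 2) * hlaw₂ + hstructL +
      ((x : L) * ((q : S₁) : L) ^ 2 - ((ht : S₁) : L)) * hv0L -
      (((W : S₁) : L) ^ 2 * ((G₁ : S₂) : L) ^ 2 + (x : L) * ((q : S₁) : L) * ((Δ : S₁) : L) +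
        (x : L) * ((q : S₁) : L) * ((W : S₁) : L) * ((G₁ : S₂) : L) + ((Δ : S₁) : L) * ((W : S₁) : L) * ((G₁ : S₂) : L)) * h2
  -- `ρ = ρ′ · x₁^e`
  obtain ⟨ρ', hρ'⟩ := pow_dvd_of_pow_two_mul_dvd_sq hx₁prime e (a := ρ) (by
    refine ⟨WS₂ ^ 2 * W₁ ^ 2 * f₂ - v' 0 * ht'', ?_⟩
    rw [← hde]
    linear_combination (-1 : S₂) * hmem₂)
  have hyp₂ : ∃ g' : S₂, v' 0 * ht'' - g' ^ 2 ∈ maximalIdeal S₂ ^ (d + 1) ⊔ Ideal.span {x₁S₂} := by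
    obtain ⟨γ₂, hγ₂⟩ := hclean₂
    refine ⟨WS₂ * W₁ * γ₂ + ρ', Ideal.mem_sup_left ?_⟩
    have hne : x₁S₂ ^ (d + 1) ≠ 0 := pow_ne_zero _ hx₁S₂0
    have key : x₁S₂ ^ (d + 1) * (v' 0 * ht'' - (WS₂ * W₁ * γ₂ + ρ') ^ 2) =
        x₁S₂ ^ (d + 1) * (WS₂ ^ 2 * W₁ ^ 2 * (f₂ - γ₂ ^ 2)) := by
      have eρ : ρ ^ 2 = x₁S₂ ^ (d + 1) * ρ' ^ 2 := by rw [hρ', hde]; ring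
      linear_combination (-1 : S₂) * hmem₂ + (-1 : S₂) * eρ -
        (x₁S₂ ^ (d + 1) * WS₂ * W₁ * γ₂ * ρ' + x₁S₂ ^ (d + 1) * ρ' ^ 2) * h2S₂
    rw [mul_left_cancel₀ hne key]
    exact Ideal.mul_mem_left _ _ hγ₂
  have hF2 := mem_sup_of_satellite_window h2 S₁ S₂ h12 hreg₂ hdim₂' x₁ hx₁0 v hx₁v v' hv hm₂ hrat₂ hde ht' hq ht''
    (by rw [hht'']) hyp₂
  -- (e) F1 at window 1 with `m = 2`, `σ' = (v₁, v₂)`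
  have hdim₁' : ringKrullDim S₁ = ((3 : ℕ) + 1 : ℕ) := by rw [hdim₁]
  set σ' : Fin 2 → S₁ := fun k => v k.succ with hσ'
  have hσ'm : ∀ k, σ' k ∈ maximalIdeal S₁ := fun k => by
    rw [← hx₁v]; exact Ideal.subset_span (Set.mem_insert_of_mem _ ⟨k.succ, rfl⟩)
  have hinput : ht ∈ Ideal.span (Set.range σ') ^ d ⊔ maximalIdeal S₁ ^ (d + 1) ⊔ Ideal.span {xS₁} := by
    have e1 : ht = ht' + xS₁ * q ^ 2 := by rw [hht']; ring
    rw [e1]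
    refine add_mem ?_ (Ideal.mem_sup_right (Ideal.mul_mem_right _ _ (Ideal.mem_span_singleton_self _)))
    obtain ⟨y, hy, w, hw, hyw⟩ := Submodule.mem_sup.mp hF2
    obtain ⟨y₁, hy₁, y₂, hy₂, rfl⟩ := Submodule.mem_sup.mp hy
    rw [← hyw]
    refine add_mem (add_mem ?_ ?_) (Ideal.mem_sup_left (Ideal.mem_sup_right hw))
    · rw [hv0'] at hy₁
      exact Ideal.mem_sup_right hy₁
    · exact Ideal.mem_sup_left (Ideal.mem_sup_left hy₂)
  have hFd : f₀ - G₀ ^ 2 ∈ maximalIdeal S₀ ^ d := hG₀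
  obtain ⟨a, hlin, hmem⟩ := mem_sup_of_window S₀ S₁ h01 hreg₁ hdim₁' x hx0 u hxu u' hu hm₁ hrat₁ (f₀ - G₀ ^ 2) ht hht hFd
    σ' hσ'm hinput
  set σ : S₀ := ∑ j, a 0 j * u j with hσdef
  set τ : S₀ := ∑ j, a 1 j * u j with hτdef
  have hrange : Set.range (fun k : Fin 2 => ∑ j, a k j * u j) = {σ, τ} := by
    ext y
    simp only [Set.mem_range, Set.mem_insert_iff, Set.mem_singleton_iff, Fin.exists_fin_two, hσdef, hτdef]
    constructor
    · rintro (h | h) <;> [exact Or.inl h.symm; exact Or.inr h.symm]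
    · rintro (h | h) <;> [exact Or.inl h.symm; exact Or.inr h.symm]
  rw [hrange] at hmem
  have hσu : σ ∈ Ideal.span (Set.range u) := Ideal.sum_mem _ fun j _ => Ideal.mul_mem_left _ _ (Ideal.subset_span ⟨j, rfl⟩)
  have hτu : τ ∈ Ideal.span (Set.range u) := Ideal.sum_mem _ fun j _ => Ideal.mul_mem_left _ _ (Ideal.subset_span ⟨j, rfl⟩)
  refine ⟨σ, τ, hσu, hτu, ?_, hmem⟩
  -- IsRsopPart from the linear parts: KEY CLAIM `c₀σ + c₁τ ∈ 𝔪₀² ⇒ c₀, c₁ ∈ 𝔪₀`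
  have hum : ∀ j, u j ∈ maximalIdeal S₀ := fun j => hxu ▸ Ideal.subset_span (Set.mem_insert_of_mem _ ⟨j, rfl⟩)
  have key : ∀ c₀ c₁ : S₀, c₀ * σ + c₁ * τ ∈ maximalIdeal S₀ ^ 2 → c₀ ∈ maximalIdeal S₀ ∧ c₁ ∈ maximalIdeal S₀ := by
    intro c₀ c₁ hc
    -- coefficients `b_j = c₀ a₀ⱼ + c₁ a₁ⱼ ∈ 𝔪₀`
    set b : Fin 3 → S₀ := fun j => c₀ * a 0 j + c₁ * a 1 j with hb
    have hbsum : c₀ * σ + c₁ * τ = ∑ j, b j * u j := by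
      simp only [hσdef, hτdef, hb, Finset.mul_sum, ← Finset.sum_add_distrib]
      refine Finset.sum_congr rfl fun j _ => by ring
    have hbm : ∀ j, b j ∈ maximalIdeal S₀ := by
      intro j
      have h := mem_maximalIdeal_of_sum_mul_rsop_mem_sq (hsfr S₀ hdim₀) z₀ hz₀span (Fin.cons 0 b) (by
        rw [Fin.sum_univ_succ]
        simp only [hz₀, Fin.cons_zero, Fin.cons_succ, zero_mul, zero_add]
        rw [← hbsum]; exact hc) j.succ
      simpa [hz₀] using h
    -- in `S₁`: `c₀ v₁ + c₁ v₂ ∈ 𝔪₁² + (x)`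
    set c₀' : S₁ := ⟨(c₀ : L), h01 c₀.2⟩ with hc₀'
    set c₁' : S₁ := ⟨(c₁ : L), h01 c₁.2⟩ with hc₁'
    have hlin0 := hlin 0
    have hlin1 := hlin 1
    have hcomb : c₀' * v 1 + c₁' * v 2 ∈ maximalIdeal S₁ ^ 2 ⊔ Ideal.span {xS₁} := by
      have hbS₁ : ∀ j, (⟨((b j : S₀) : L), h01 (b j).2⟩ : S₁) ∈ Ideal.span {xS₁} := fun j =>
        inclusion_mem_span_of_mem_maximalIdeal h01 x u hxu u' hu (hbm j)
      have e1 : c₀' * v 1 + c₁' * v 2 =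
          c₀' * (σ' 0 - ∑ j, (⟨((a 0 j : S₀) : L), h01 (a 0 j).2⟩ : S₁) * u' j) +
          c₁' * (σ' 1 - ∑ j, (⟨((a 1 j : S₀) : L), h01 (a 1 j).2⟩ : S₁) * u' j) +
          ∑ j, (⟨((b j : S₀) : L), h01 (b j).2⟩ : S₁) * u' j := by
        have hbj : ∀ j, (⟨((b j : S₀) : L), h01 (b j).2⟩ : S₁) =
            c₀' * ⟨((a 0 j : S₀) : L), h01 (a 0 j).2⟩ + c₁' * ⟨((a 1 j : S₀) : L), h01 (a 1 j).2⟩ := fun j =>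
          Subtype.ext (by simp [hb, hc₀', hc₁'])
        simp only [hbj, hσ', Finset.mul_sum, add_mul, Finset.sum_add_distrib, mul_sub]
        have e2 : (Fin.succ (0 : Fin 2) : Fin 3) = 1 := rfl
        have e3 : (Fin.succ (1 : Fin 2) : Fin 3) = 2 := rfl
        rw [e2, e3]
        simp only [mul_assoc]
        ring
      rw [e1]
      refine add_mem (add_mem (Ideal.mul_mem_left _ _ hlin0) (Ideal.mul_mem_left _ _ hlin1))
        (Ideal.mem_sup_right (Ideal.sum_mem _ fun j _ => Ideal.mul_mem_right _ _ (hbS₁ j)))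
    obtain ⟨m, hm, w, hw, hmw⟩ := Submodule.mem_sup.mp hcomb
    obtain ⟨r, hr⟩ := Ideal.mem_span_singleton'.mp hw
    -- coefficient vector on the system `(x₁, v₀ = x, v₁, v₂)`: `(0, −r, c₀, c₁)`
    have hcS₁ : c₀' ∈ maximalIdeal S₁ ∧ c₁' ∈ maximalIdeal S₁ := by
      set cvec : Fin 4 → S₁ := Fin.cons 0 (Fin.cons (-r) (Fin.cons c₀' (Fin.cons c₁' Fin.elim0))) with hcvec
      have hsum : ∑ i, cvec i * z₁ i = c₀' * v 1 + c₁' * v 2 - w := by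
        rw [← hr]
        simp only [Fin.sum_univ_succ, Fin.sum_univ_zero, hcvec, hz₁, Fin.cons_zero, Fin.cons_succ]
        simp only [Fin.succ_zero_eq_one, Fin.succ_one_eq_two, hv0']
        ring
      have hmem' : ∑ i, cvec i * z₁ i ∈ maximalIdeal S₁ ^ 2 := by
        rw [hsum, ← hmw]; simpa using hm
      have h2' := mem_maximalIdeal_of_sum_mul_rsop_mem_sq (hsfr S₁ hdim₁) z₁ hz₁span cvec hmem'
      have h2a := h2' (Fin.succ (Fin.succ 0))
      have h2b := h2' (Fin.succ (Fin.succ (Fin.succ 0)))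
      simp only [hcvec, Fin.cons_succ, Fin.cons_zero] at h2a h2b
      exact ⟨h2a, h2b⟩
    -- back to `S₀`: a unit of `S₀` is a unit of `S₁`
    constructor
    · by_contra hc₀
      have hu0 : IsUnit c₀ := IsLocalRing.notMem_maximalIdeal.mp hc₀
      have : IsUnit c₀' := (hu0.map (Subring.inclusion h01))
      exact (IsLocalRing.mem_maximalIdeal _).mp hcS₁.1 this
    · by_contra hc₁
      have hu1 : IsUnit c₁ := IsLocalRing.notMem_maximalIdeal.mp hc₁
      have : IsUnit c₁' := (hu1.map (Subring.inclusion h01))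
      exact (IsLocalRing.mem_maximalIdeal _).mp hcS₁.2 this
  have hσm : σ ∈ maximalIdeal S₀ := Ideal.sum_mem _ fun j _ => Ideal.mul_mem_left _ _ (hum j)
  have hτm : τ ∈ maximalIdeal S₀ := Ideal.sum_mem _ fun j _ => Ideal.mul_mem_left _ _ (hum j)
  have hσ2 : σ ∉ maximalIdeal S₀ ^ 2 := fun h => by
    have := (key 1 0 (by simpa using h)).1
    exact (IsLocalRing.maximalIdeal.isMaximal S₀).ne_top (Ideal.eq_top_of_isUnit_mem _ this isUnit_one)
  have hτ2 : τ ∉ maximalIdeal S₀ ^ 2 ⊔ Ideal.span {σ} := fun h => by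
    obtain ⟨m, hm, w, hw, hmw⟩ := Submodule.mem_sup.mp h
    obtain ⟨r, hr⟩ := Ideal.mem_span_singleton'.mp hw
    have : (-r) * σ + 1 * τ ∈ maximalIdeal S₀ ^ 2 := by
      have e1 : (-r) * σ + 1 * τ = m := by rw [← hmw, ← hr]; ring
      rw [e1]; exact hm
    have := (key (-r) 1 this).2
    exact (IsLocalRing.maximalIdeal.isMaximal S₀).ne_top (Ideal.eq_top_of_isUnit_mem _ this isUnit_one)
  exact SwitchPlane.isRsopPart_pair hσm hσ2 hτm hτ2

end assembly

end Summit.ResolutionOfSingularities.ResolutionOfSingularities.Theorems.SwitchingDichotomy.BinaryResidue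

end
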